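import Summits.Ventures.CertifiedManyBodySolver.Rows.TLSpinStar
import Summits.Ventures.CertifiedManyBodySolver.Rows.DopedTLCorr
import Summits.Ventures.CertifiedManyBodySolver.Certificates.HubbardSquare_n7o8_corr_spin_nnn
import HarnessLib

/-!
# Derived M3′ spin-correlator LOWER rows from the star inequality (`U = 8`, `n = 7/8`, `t′ ∈ {0, -1/4}`)

HONEST FRAMING: first certified bounds; not a superconductivity verdict; every number certified or
labelled float.  (Speedrun `mbsolver`, seat sr-mbsolver-m3-2, gen 10.)  Row class: DERIVED = a Lean
theorem (`Rows/TLSpinStar.lean`, the translation-invariant star inequality) composed with a row of the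
table; the docc-parametric rows take a docc LOWER row `M3DoccLowerRow tp u dlo` as a HYPOTHESIS (no docc
claim node is typed here), the KINEMATIC rows take nothing (translation invariance + density `7/8` +
`n_{0↑}n_{0↓} ⪰ 0`; the energy hypothesis of the row predicate is not used).

* `spinDotNNN2B_eq`: the literal objective of rows #73 / #98 is the two-arm diagonal word
  `(1/2)(𝐒_0·𝐒_{e₁+e₂} + 𝐒_0·𝐒_{e₂-e₁})`;
* `m3_spin_nnn_orbit_lower_kinematic`: `M3CorrOrbitLowerRow tp u (-21/64) S nnnSupportB spinDotNNN2B`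
  for EVERY `tp`, `u` and nonempty `S ⊆ D₄` — the orbit-mean cell shape of #73 / #98 with lower slot
  `-21/64 = -0.328125`, above their certified lower edges (`≈ -0.3529260` resp. `≈ -0.3731490`, floats);
* `m3_spin_nnn_orbit_lower_of_docc`: slot `-21/64 + (3/4)·dlo` from `M3DoccLowerRow tp u dlo`;
* `m3_spin_pair_lower_kinematic` / `_of_docc`: `M3CorrLowerRow tp u (-7/16 [+ dlo]) {0, r} (𝐒_0·𝐒_r)` for
  every displacement `r ≠ 0` (a typed KINEMATIC / DERIVED lower cell at every displacement).

The NN shell instance (`a = e₁`, `b = e₂` in `half_add_corr_ge`: `≥ -21/64 + (3/4)·dlo`) is weaker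
than the certified NN lower edges of record (#71 `≈ -0.2822`, #96 `≈ -0.2857`, floats) and is not restated.
-/

noncomputable section

namespace Summit.Ventures.CertifiedManyBodySolver

open Matrix Literature.MathematicalPhysics.QuantumLattice Literature.Probability.LatticeModels
open Literature.MathematicalPhysics.QuantumLattice.HubbardWave0
open Literature.MathematicalPhysics.QuantumLattice.FermionSpinMoment
open ThermodynamicLimit Filter Topology
open scoped BigOperators ComplexOrder

namespace SpinStarTL

/-! ## §3 The square lattice: `D₄` images, the literal NNN word, and the M3′ rows -/

section Square

open Summit.Ventures.CertifiedManyBodySolver.Certificates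

/-- `d4Vec γ (-e) = -d4Vec γ e` (the point-group action is linear). [cite: Scalapino1995, §2] -/
theorem d4Vec_neg (γ : DihedralGroup 4) (e : Site 2) : d4Vec γ (-e) = -d4Vec γ e := by
  have hrot1 : ∀ v : Site 2, (![-(-v) 1, (-v) 0] : Site 2) = -(![-v 1, v 0] : Site 2) := by
    intro v; funext i; fin_cases i <;> simp
  have hrefl1 : ∀ v : Site 2, (![(-v) 0, -(-v) 1] : Site 2) = -(![v 0, -v 1] : Site 2) := by
    intro v; funext i; fin_cases i <;> simp
  have hrot : ∀ (n : ℕ) (e : Site 2), (fun v : Site 2 => (![-v 1, v 0] : Site 2))^[n] (-e) =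
      -((fun v : Site 2 => (![-v 1, v 0] : Site 2))^[n] e) := by
    intro n
    induction n with
    | zero => intro e; rfl
    | succ n ih =>
      intro e
      rw [Function.iterate_succ_apply', Function.iterate_succ_apply', ih, hrot1]
  cases γ with
  | r i => exact hrot i.val e
  | sr i =>
    simp only [d4Vec]
    rw [hrot i.val e, hrefl1]

/-- `d4Vec γ 0 = 0`. [folklore] -/
theorem d4Vec_zero (γ : DihedralGroup 4) : d4Vec γ 0 = 0 := (d4Vec_eq_zero_iff γ 0).2 rfl

/-- `e₁ + e₂ ≠ 0` in `ℤ²`. [folklore] -/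
theorem e1pe2_ne_zero : (unitVec 0 + unitVec 1 : Site 2) ≠ 0 := fun h => by
  simpa [unitVec] using congrFun h 0

/-- `e₂ - e₁ ≠ 0` in `ℤ²`. [folklore] -/
theorem e2me1_ne_zero : (unitVec 1 - unitVec 0 : Site 2) ≠ 0 := fun h => by
  simpa [unitVec] using congrFun h 1

/-- `e₁ + e₂ ≠ e₂ - e₁`. [folklore] -/
theorem e1pe2_ne_e2me1 : (unitVec 0 + unitVec 1 : Site 2) ≠ unitVec 1 - unitVec 0 := fun h => by
  simpa [unitVec] using congrFun h 0

/-- `e₁ + e₂ ≠ -(e₂ - e₁)`. [folklore] -/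
theorem e1pe2_ne_neg_e2me1 : (unitVec 0 + unitVec 1 : Site 2) ≠ -(unitVec 1 - unitVec 0) := fun h => by
  simpa [unitVec] using congrFun h 1

/-- **The literal row objective IS the two-arm NNN word**:
`spinDotNNN2B = (1/2)(𝐒_0·𝐒_{e₁+e₂} + 𝐒_0·𝐒_{e₂-e₁})` (normal-ordered expansion of each arm).
[cite: EsslerEtAl2005, §2.2.5 eq. (2.66) and (2.71)–(2.73)] -/
theorem spinDotNNN2B_eq : spinDotNNN2B =
    (1 / 2 : ℂ) • (spinDotAt 0 zero_mem_nnnSupportB (unitVec 0 + unitVec 1) e1pe2_mem_nnnSupportB +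
      spinDotAt 0 zero_mem_nnnSupportB (unitVec 1 - unitVec 0) e2me1_mem_nnnSupportB) := by
  unfold spinDotNNN2B
  rw [spinDotAt_eq_normalOrder e1pe2_ne_zero.symm, spinDotAt_eq_normalOrder e2me1_ne_zero.symm]
  simp only [cNNNB]
  push_cast
  module

variable {ω : InfVolFermionState 2}

/-- **`Re ω(spinDotNNN2B) = (1/2)(C_ω(e₁+e₂) + C_ω(e₂-e₁))`**, `C_ω(v) = Re ω_{{0,v}}(𝐒_0·𝐒_v)`, for
translation-invariant `ω`.
[cite: ArakiMoriya2003, §4.1 Def. 4.5] -/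
theorem re_expect_spinDotNNN2B_eq (hω : ω.IsTranslationInvariant) :
    (ω.expect nnnSupportB spinDotNNN2B).re =
      (1 / 2) * ((ω.expect {0, unitVec 0 + unitVec 1} (spinDotAt 0 (Finset.mem_insert_self 0 {unitVec 0 + unitVec 1}) (unitVec 0 + unitVec 1)
        (Finset.mem_insert_of_mem (Finset.mem_singleton_self (unitVec 0 + unitVec 1))))).re +
        (ω.expect {0, unitVec 1 - unitVec 0} (spinDotAt 0 (Finset.mem_insert_self 0 {unitVec 1 - unitVec 0}) (unitVec 1 - unitVec 0)
        (Finset.mem_insert_of_mem (Finset.mem_singleton_self (unitVec 1 - unitVec 0))))).re) := by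
  rw [spinDotNNN2B_eq, map_smul, map_add, smul_eq_mul, show (1 / 2 : ℂ) = ((1 / 2 : ℝ) : ℂ) by norm_num,
    Complex.re_ofReal_mul, Complex.add_re,
    re_expect_spinDotAt_eq_corr hω (Λ := nnnSupportB) 0 (unitVec 0 + unitVec 1),
    re_expect_spinDotAt_eq_corr hω (Λ := nnnSupportB) 0 (unitVec 1 - unitVec 0)]
  exact congrArg₂ (fun a b : ℝ => (1 / 2) * (a + b)) (corr_congr ω (sub_zero _)) (corr_congr ω (sub_zero _))

/-- **The NNN shell bound for translation-invariant states**: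
`Re ω(spinDotNNN2B) ≥ -(3/8)(ρ(ω) - 2 Re ω(n_{0↑}n_{0↓}))` — translation invariance alone (no point
group): the four-arm star `{±(e₁+e₂), ±(e₂-e₁)}`. [cite: Tasaki2020, App. A.3] -/
theorem re_expect_spinDotNNN2B_ge (hω : ω.IsTranslationInvariant) :
    -((3 / 8) * (ω.density - 2 * (ω.expect {0} (doccAt0 2)).re)) ≤
      (ω.expect nnnSupportB spinDotNNN2B).re := by
  rw [re_expect_spinDotNNN2B_eq hω]
  exact half_add_corr_ge hω e1pe2_ne_zero e2me1_ne_zero e1pe2_ne_e2me1 e1pe2_ne_neg_e2me1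

/-- **The same bound for every `D₄` image** `Γ(d4Emb γ 0) spinDotNNN2B ∈ 𝔄_{γ·nnnSupportB}` (again two
orthogonal diagonal arms from `0`; `d4Vec` is linear and injective). [cite: Scalapino1995, §2] -/
theorem re_expect_d4_spinDotNNN2B_ge (hω : ω.IsTranslationInvariant) (γ : DihedralGroup 4) :
    -((3 / 8) * (ω.density - 2 * (ω.expect {0} (doccAt0 2)).re)) ≤
      (ω.expect (d4ShiftSet γ 0 nnnSupportB)
        (fermionEmbed (PolySite.d4Emb γ 0 nnnSupportB) spinDotNNN2B)).re := by
  rw [spinDotNNN2B_eq, map_smul, map_add]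
  simp only [spinDotAt, fermionEmbed_fermionSpinDot]
  rw [map_smul, map_add, smul_eq_mul, show (1 / 2 : ℂ) = ((1 / 2 : ℝ) : ℂ) by norm_num,
    Complex.re_ofReal_mul, Complex.add_re]
  have h1 : ofLex (PolySite.d4Emb γ 0 nnnSupportB (PolySite.pt (unitVec 0 + unitVec 1)
      e1pe2_mem_nnnSupportB)).1 - ofLex (PolySite.d4Emb γ 0 nnnSupportB (PolySite.pt 0
      zero_mem_nnnSupportB)).1 = d4Vec γ (unitVec 0 + unitVec 1) := by
    simp only [PolySite.ofLex_coe_d4Emb, PolySite.ofLex_coe_pt, d4Vec_zero, add_zero, sub_zero]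
  have h2 : ofLex (PolySite.d4Emb γ 0 nnnSupportB (PolySite.pt (unitVec 1 - unitVec 0)
      e2me1_mem_nnnSupportB)).1 - ofLex (PolySite.d4Emb γ 0 nnnSupportB (PolySite.pt 0
      zero_mem_nnnSupportB)).1 = d4Vec γ (unitVec 1 - unitVec 0) := by
    simp only [PolySite.ofLex_coe_d4Emb, PolySite.ofLex_coe_pt, d4Vec_zero, add_zero, sub_zero]
  refine half_add_re_expect_fermionSpinDot_ge hω _ _ _ ?_ ?_ ?_ ?_
  · rw [h1]; exact fun h => e1pe2_ne_zero ((d4Vec_eq_zero_iff γ _).1 h)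
  · rw [h2]; exact fun h => e2me1_ne_zero ((d4Vec_eq_zero_iff γ _).1 h)
  · rw [h1, h2]; exact fun h => e1pe2_ne_e2me1 (d4Vec_injective γ h)
  · rw [h1, h2, ← d4Vec_neg]; exact fun h => e1pe2_ne_neg_e2me1 (d4Vec_injective γ h)

/-- Averaging a pointwise lower bound. [folklore] -/
private theorem le_inv_card_mul_sum {S : Finset (DihedralGroup 4)} (hS : S.Nonempty) {c : ℝ}
    {f : DihedralGroup 4 → ℝ} (h : ∀ g ∈ S, c ≤ f g) : c ≤ (S.card : ℝ)⁻¹ * ∑ g ∈ S, f g := by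
  have hc : (0 : ℝ) < S.card := by exact_mod_cast hS.card_pos
  rw [le_inv_mul_iff₀ hc, ← nsmul_eq_mul, ← Finset.sum_const]
  exact Finset.sum_le_sum h

/-! ### The M3′ rows (`U = 8`, `n = 7/8`, `tp ∈ {0, -1/4}`): class DERIVED -/

variable {tp : ℝ} {u dlo : ℚ}

/-- The states of the M3′ rows are translation invariant with density `7/8`.
[cite: BratteliRobinsonII1997, §6.2.4] -/
theorem m3_rowState_invariances {Ls : ℕ → ℕ} {ψ : ∀ L, Fock (Orb (FermionTorus 2 L))}
    (hLs : Tendsto Ls atTop atTop)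
    (hψ : ∀ j, IsGroundStateInSector (hubbardTorusTT' (Ls j) 1 tp 8) (rectN (7 / 8) (Ls j)) 0 (ψ (Ls j)))
    (hψ1 : ∀ j, star (ψ (Ls j)) ⬝ᵥ ψ (Ls j) = 1) (hω : ω.IsTorusLimitOf ψ Ls) :
    ω.IsTranslationInvariant ∧ ω.density = 7 / 8 :=
  ⟨hω.isTranslationInvariant,
    hω.density_eq_of_rectN hLs (by norm_num) (fun j => ((mem_szSector_iff _ _ _).1 (hψ j).1).1) hψ1⟩

/-- **KINEMATIC NNN row (no certificate, every `tp`, every window `u`)**: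
`M3CorrLowerRow tp u (-21/64) nnnSupportB spinDotNNN2B` — for every torus-limit sector ground state of
the class, `Re ω(spinDotNNN2B) ≥ -21/64 = -0.328125` (translation invariance, density `7/8`,
`n_{0↑}n_{0↓} ⪰ 0`; the energy hypothesis is not used).  Already above the CERTIFIED orbit-mean lower
edges of record #73 (`≈ -0.3529260`, `t′ = 0`) and #98 (`≈ -0.3731490`, `t′ = -1/4`) (floats, labels).
[cite: Tasaki2020, App. A.3] -/
theorem m3_spin_nnn_lower_kinematic (tp : ℝ) (u : ℚ) :
    M3CorrLowerRow tp u (-21 / 64) nnnSupportB spinDotNNN2B := by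
  intro ω Ls ψ hLs hψ hψ1 hω _
  obtain ⟨hTI, hn⟩ := m3_rowState_invariances hLs hψ hψ1 hω
  have hd := re_expect_doccAt0_nonneg ω (d := 2)
  have key := re_expect_spinDotNNN2B_ge hTI
  rw [hn] at key
  push_cast
  linarith

/-- **DERIVED NNN row from a docc LOWER row** (class `derived (Lean theorem ∘ certified row)`):
`M3DoccLowerRow tp u dlo` gives `M3CorrLowerRow tp u (-21/64 + (3/4)·dlo) nnnSupportB spinDotNNN2B`, i.e.
`Re ω(spinDotNNN2B) ≥ -(3/8)(7/8 - 2·dlo)` on the same state class and window.  (Float labels: with the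
m3-4 TLw3 docc lowers `dlo ≈ 0.0131` (`t′ = 0`) / `≈ 0.0051` (`t′ = -1/4`) the slot is `≈ -0.3183` /
`≈ -0.3243`; no docc claim node is typed in this file.) [cite: WangEtAl2024, §III] -/
theorem m3_spin_nnn_lower_of_docc (h : M3DoccLowerRow tp u dlo) :
    M3CorrLowerRow tp u (-21 / 64 + 3 / 4 * dlo) nnnSupportB spinDotNNN2B := by
  intro ω Ls ψ hLs hψ hψ1 hω hu
  obtain ⟨hTI, hn⟩ := m3_rowState_invariances hLs hψ hψ1 hω
  have hd : ((dlo : ℚ) : ℝ) ≤ (ω.expect {0} (doccAt0 2)).re := h ω Ls ψ hLs hψ hψ1 hω hu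
  have key := re_expect_spinDotNNN2B_ge hTI
  rw [hn] at key
  push_cast
  linarith

/-- **KINEMATIC NNN orbit-mean row** — the LITERAL cell shape of rows #73 / #98
(`M3CorrOrbitLowerRow tp u r S nnnSupportB spinDotNNN2B`, any nonempty label set `S ⊆ D₄`, in particular
`Finset.univ`) with `r = -21/64`, for every `tp` and `u`. [cite: Tasaki2020, App. A.3] -/
theorem m3_spin_nnn_orbit_lower_kinematic (tp : ℝ) (u : ℚ) {S : Finset (DihedralGroup 4)}
    (hS : S.Nonempty) : M3CorrOrbitLowerRow tp u (-21 / 64) S nnnSupportB spinDotNNN2B := by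
  intro ω Ls ψ hLs hψ hψ1 hω _
  obtain ⟨hTI, hn⟩ := m3_rowState_invariances hLs hψ hψ1 hω
  have hd := re_expect_doccAt0_nonneg ω (d := 2)
  refine le_inv_card_mul_sum hS fun g _ => ?_
  have key := re_expect_d4_spinDotNNN2B_ge hTI g
  rw [hn] at key
  push_cast
  linarith

/-- **DERIVED NNN orbit-mean row from a docc LOWER row**: `M3DoccLowerRow tp u dlo` gives
`M3CorrOrbitLowerRow tp u (-21/64 + (3/4)·dlo) S nnnSupportB spinDotNNN2B` for every nonempty `S ⊆ D₄` —
directly comparable, at `S = Finset.univ`, with the certified lower edges of rows #73 / #98.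
[cite: WangEtAl2024, §III] -/
theorem m3_spin_nnn_orbit_lower_of_docc (h : M3DoccLowerRow tp u dlo) {S : Finset (DihedralGroup 4)}
    (hS : S.Nonempty) : M3CorrOrbitLowerRow tp u (-21 / 64 + 3 / 4 * dlo) S nnnSupportB spinDotNNN2B := by
  intro ω Ls ψ hLs hψ hψ1 hω hu
  obtain ⟨hTI, hn⟩ := m3_rowState_invariances hLs hψ hψ1 hω
  have hd : ((dlo : ℚ) : ℝ) ≤ (ω.expect {0} (doccAt0 2)).re := h ω Ls ψ hLs hψ hψ1 hω hu
  refine le_inv_card_mul_sum hS fun g _ => ?_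
  have key := re_expect_d4_spinDotNNN2B_ge hTI g
  rw [hn] at key
  push_cast
  linarith

/-- **KINEMATIC single-displacement rows, every `r ≠ 0`**: `M3CorrLowerRow tp u (-7/16) {0, r} (𝐒_0·𝐒_r)`
— `Re ω(𝐒_0·𝐒_r) ≥ -(1/2)·(7/8) = -0.4375` for every torus-limit sector ground state (the two-arm star;
translation invariance only). [cite: Tasaki2020, App. A.3] -/
theorem m3_spin_pair_lower_kinematic (tp : ℝ) (u : ℚ) {r : Site 2} (hr : r ≠ 0) :
    M3CorrLowerRow tp u (-7 / 16) {0, r} (spinDotAt 0 (Finset.mem_insert_self 0 {r}) r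
      (Finset.mem_insert_of_mem (Finset.mem_singleton_self r))) := by
  intro ω Ls ψ hLs hψ hψ1 hω _
  obtain ⟨hTI, hn⟩ := m3_rowState_invariances hLs hψ hψ1 hω
  have hd := re_expect_doccAt0_nonneg ω (d := 2)
  have key := corr_ge hTI hr
  rw [hn] at key
  push_cast
  linarith

/-- **DERIVED single-displacement rows from a docc LOWER row**: `M3DoccLowerRow tp u dlo` gives
`M3CorrLowerRow tp u (-7/16 + dlo) {0, r} (𝐒_0·𝐒_r)` for every `r ≠ 0`. [cite: WangEtAl2024, §III] -/
theorem m3_spin_pair_lower_of_docc (h : M3DoccLowerRow tp u dlo) {r : Site 2} (hr : r ≠ 0) :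
    M3CorrLowerRow tp u (-7 / 16 + dlo) {0, r} (spinDotAt 0 (Finset.mem_insert_self 0 {r}) r
      (Finset.mem_insert_of_mem (Finset.mem_singleton_self r))) := by
  intro ω Ls ψ hLs hψ hψ1 hω hu
  obtain ⟨hTI, hn⟩ := m3_rowState_invariances hLs hψ hψ1 hω
  have hd : ((dlo : ℚ) : ℝ) ≤ (ω.expect {0} (doccAt0 2)).re := h ω Ls ψ hLs hψ hψ1 hω hu
  have key := corr_ge hTI hr
  rw [hn] at key
  push_cast
  linarith

end Square

end SpinStarTL

end Summit.Ventures.CertifiedManyBodySolver
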